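import Mathlib.Algebra.MvPolynomial.Basic
import Mathlib.RingTheory.RootsOfUnity.PrimitiveRoots
import Mathlib.Tactic
import HarnessLib

/-!
# Weight congruence of eigen-polynomials under a root-of-unity scaling

Kernel leaf for the W1 census line of cell `pub-hsemireg` (seat w1-cx-1 gen 11, note
`widen/W1/OVAL-w1cx1.md` §2, LEMMA O-CHAR): the algebraic core of «a `μ₆`-eigenfunction of weight `w`
near the fixed point `O` has `ord_O ≡ -w (mod 6)`».

Setting: a field `K`, a primitive `n`-th root of unity `ζ : K`, integer weights `q i` on the variables,
and the diagonal scaling `X i ↦ ζ ^ (q i) • X i` of `MvPolynomial σ K`.  We prove: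
* `coeff_scale`: the scaling multiplies the coefficient of the monomial `m` by `ζ ^ (weighted degree of m)`;
* `wdeg_modEq_of_eigen`: if `P` is an EIGENVECTOR of the scaling with eigenvalue `ζ ^ k`, then
  every monomial in the support of `P` has weighted degree `≡ k (mod n)` — in particular the least one
  (the order at the fixed point) and the largest one.

Honest framing: elementary algebra (theorems only); nothing here bears on HC / HC_CM / HC_AV.
-/

namespace Summit.Ventures.HSemireg.FixedPointWeightCongruence

open MvPolynomial

variable {K : Type*} [Field K] {σ : Type*}

/-! Notation (inlined, no definitions): the diagonal scaling is the `K`-algebra map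
`aeval (fun i => C (ζ ^ q i) * X i)`, and the weighted degree of an exponent vector `m` is
`m.sum (fun i e => q i * e)`. -/

/-- The scaling acts on a monomial by the scalar `ζ ^ (weighted degree)`. -/
theorem scale_monomial (ζ : K) (q : σ → ℕ) (m : σ →₀ ℕ) (a : K) :
    aeval (fun i => C (ζ ^ q i) * X i) (monomial m a) = monomial m (ζ ^ (m.sum fun i e => q i * e) * a) := by
  classical
  rw [aeval_monomial, algebraMap_eq]
  have h1 : (m.prod fun i k => (C (ζ ^ q i) * X i : MvPolynomial σ K) ^ k)
      = (∏ i ∈ m.support, C ((ζ ^ q i) ^ m i)) * ∏ i ∈ m.support, (X i : MvPolynomial σ K) ^ m i := by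
    rw [Finsupp.prod, ← Finset.prod_mul_distrib]
    apply Finset.prod_congr rfl
    intro i _
    rw [mul_pow, ← map_pow]
  have h2 : (∏ i ∈ m.support, C ((ζ ^ q i) ^ m i)) = (C (ζ ^ (m.sum fun i e => q i * e)) : MvPolynomial σ K) := by
    rw [← map_prod]
    congr 1
    rw [Finsupp.sum, ← Finset.prod_pow_eq_pow_sum]
    apply Finset.prod_congr rfl
    intro i _
    rw [pow_mul]
  rw [h1, h2, prod_X_pow_eq_monomial, C_mul_monomial, C_mul_monomial]
  congr 1
  ring

/-- Coefficient formula: the scaling multiplies `coeff m` by `ζ ^ (weighted degree of m)`. -/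
theorem coeff_scale (ζ : K) (q : σ → ℕ) (P : MvPolynomial σ K) (m : σ →₀ ℕ) :
    coeff m (aeval (fun i => C (ζ ^ q i) * X i) P) = ζ ^ (m.sum fun i e => q i * e) * coeff m P := by
  classical
  induction P using MvPolynomial.induction_on' with
  | monomial u a =>
    rw [scale_monomial, coeff_monomial, coeff_monomial]
    by_cases h : u = m
    · subst h; simp
    · simp [h]
  | add p r hp hr =>
    rw [map_add, coeff_add, coeff_add, hp, hr, mul_add]

/-- Powers of a primitive `n`-th root of unity agree iff the exponents agree modulo `n`. -/
theorem pow_eq_pow_iff_modEq {ζ : K} {n : ℕ} (hζ : IsPrimitiveRoot ζ n) (hn : 0 < n) (a b : ℕ) :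
    ζ ^ a = ζ ^ b ↔ a ≡ b [MOD n] := by
  have hz : ζ ≠ 0 := hζ.ne_zero hn.ne'
  constructor
  · intro h
    rcases le_total a b with hab | hab
    · obtain ⟨c, rfl⟩ := Nat.exists_eq_add_of_le hab
      rw [pow_add] at h
      have h1 : ζ ^ c = 1 := by
        have := mul_left_cancel₀ (pow_ne_zero a hz) (h.symm.trans (mul_one (ζ ^ a)).symm)
        exact this
      have hd : n ∣ c := (hζ.pow_eq_one_iff_dvd c).mp h1
      exact (Nat.modEq_iff_dvd' (Nat.le_add_right a c)).mpr (by simpa using hd)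
    · obtain ⟨c, rfl⟩ := Nat.exists_eq_add_of_le hab
      rw [pow_add] at h
      have h1 : ζ ^ c = 1 := by
        have := mul_left_cancel₀ (pow_ne_zero b hz) (h.trans (mul_one (ζ ^ b)).symm)
        exact this
      have hd : n ∣ c := (hζ.pow_eq_one_iff_dvd c).mp h1
      exact ((Nat.modEq_iff_dvd' (Nat.le_add_right b c)).mpr (by simpa using hd)).symm
  · intro h
    rcases le_total a b with hab | hab
    · obtain ⟨c, rfl⟩ := Nat.exists_eq_add_of_le hab
      have hd : n ∣ c := by
        have := (Nat.modEq_iff_dvd' (Nat.le_add_right a c)).mp h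
        simpa using this
      rw [pow_add, (hζ.pow_eq_one_iff_dvd c).mpr hd, mul_one]
    · obtain ⟨c, rfl⟩ := Nat.exists_eq_add_of_le hab
      have hd : n ∣ c := by
        have := (Nat.modEq_iff_dvd' (Nat.le_add_right b c)).mp h.symm
        simpa using this
      rw [pow_add, (hζ.pow_eq_one_iff_dvd c).mpr hd, mul_one]

/-- **Weight congruence.** If `P` is an eigenvector of the diagonal scaling by a primitive `n`-th root of
unity with eigenvalue `ζ ^ k`, then every monomial in the support of `P` has weighted degree `≡ k (mod n)`. -/
theorem wdeg_modEq_of_eigen {ζ : K} {n : ℕ} (hζ : IsPrimitiveRoot ζ n) (hn : 0 < n) (q : σ → ℕ)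
    {P : MvPolynomial σ K} {k : ℕ} (hP : aeval (fun i => C (ζ ^ q i) * X i) P = C (ζ ^ k) * P)
    {m : σ →₀ ℕ} (hm : m ∈ P.support) : (m.sum fun i e => q i * e) ≡ k [MOD n] := by
  classical
  have hc : coeff m P ≠ 0 := mem_support_iff.mp hm
  have h1 : ζ ^ (m.sum fun i e => q i * e) * coeff m P = ζ ^ k * coeff m P := by
    rw [← coeff_scale, hP, coeff_C_mul]
  have h2 : ζ ^ (m.sum fun i e => q i * e) = ζ ^ k := mul_right_cancel₀ hc h1
  exact (pow_eq_pow_iff_modEq hζ hn _ _).mp h2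

/-- The ORDER version used at the fixed point: the least weighted degree occurring in an eigen-polynomial
(its order of vanishing at the origin when all weights are `1`) is `≡ k (mod n)`, and so is every other
occurring weighted degree; stated as: any two occurring weighted degrees are congruent mod `n`. -/
theorem wdeg_modEq_wdeg_of_eigen {ζ : K} {n : ℕ} (hζ : IsPrimitiveRoot ζ n) (hn : 0 < n) (q : σ → ℕ)
    {P : MvPolynomial σ K} {k : ℕ} (hP : aeval (fun i => C (ζ ^ q i) * X i) P = C (ζ ^ k) * P)
    {m m' : σ →₀ ℕ} (hm : m ∈ P.support) (hm' : m' ∈ P.support) :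
    (m.sum fun i e => q i * e) ≡ (m'.sum fun i e => q i * e) [MOD n] :=
  (wdeg_modEq_of_eigen hζ hn q hP hm).trans (wdeg_modEq_of_eigen hζ hn q hP hm').symm

/-- Products of eigen-polynomials are eigen-polynomials with the product eigenvalue (weights add) — the
multiplicativity used for `σ(a·b) = σ(a) + σ(b)` bookkeeping in the O-CHAR lemma. -/
theorem eigen_mul {ζ : K} (q : σ → ℕ) {P Q : MvPolynomial σ K} {k l : ℕ}
    (hP : aeval (fun i => C (ζ ^ q i) * X i) P = C (ζ ^ k) * P)
    (hQ : aeval (fun i => C (ζ ^ q i) * X i) Q = C (ζ ^ l) * Q) :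
    aeval (fun i => C (ζ ^ q i) * X i) (P * Q) = C (ζ ^ (k + l)) * (P * Q) := by
  rw [map_mul, hP, hQ, pow_add, C_mul]
  ring

end Summit.Ventures.HSemireg.FixedPointWeightCongruence
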